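import Literature.NumberTheory.Rogawski1990.ArchBouazizStableFamilyJumpZero       -- ★ p850206 (LH10-p02 (g3)): (J-H) ORDER-0 jump VALUE (`hP`∕`hG1`∕`hQ` by statement)
import Literature.NumberTheory.Automorphic.ArchEndoscopicChartOrbPlaces            -- ★ p850200∕p850227 (LH3-p03 (g3)): (P1) `chartOrbH_eq_prod_chartOrbHLoc`, (P4) `chartOrbHLoc_eq_integral_of_not_mem`
import Literature.NumberTheory.Automorphic.ArchEndoscopicChartOrbLocalCongr        -- ★ (T-CONGR) (this seat): `chartOrbHLoc_insert_of_ne`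
import HarnessLib

/-!
# (J-H) ORDER 0 ON PRODUCT TEST FUNCTIONS: the jump of `stOrbFamH L νH fH S` at a noncompact imaginary wall, binder-free, and its docking `= cH · Ψ_{S′}(cayPt)`
# (Shelstad 1979 Lemma 4.3, Thm. 4.7 (IIIb); Bouaziz 1994 §3.2 (I₃), §6.2; Rogawski 1990 §8.2)

Topic `NumberTheory/Rogawski1990`; namespace `Literature.NumberTheory.Rogawski1990`.  THEOREMS ONLY (no `def`, no instance, no notation, no axiom, no named fact, no `sorry`).
Cell `pub/hodgecm-mathlib`, line LH3 (closer stub `stub_N9`, crux H413 = `stmt-HodgeConjecture-24833`), DIRECT ROAD organ J, brick (J-H) EDITIONS 1½ + 2 (LH3-plan (g3)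
2026-09-02T07:18:44Z deal to LH10-p02, RULINGS #4 07:40:37Z (JH) shape); author LH10-p02 (g4).  Count-neutral.

WHAT IS PROVED.
* §1 `endoTorus_snd_eq_of_forall_apply_one` — the `U(Φ₁)`-component of the chart reads slot `1` only and NO label: `(endoTorus L S c).2 = (endoTorus L S′ c′).2` whenever
  `c w 1 = c′ w 1` for all `w`; `cayPt_apply_one` — the Cayley point keeps slot `1`.
* §2 **`exists_hasOneSidedJump_stOrbFamH_add_smul_nrm_prod`** — ★ p850206's jump VALUE with its three by-statement binders DISCHARGED on the product road: under the product
  Haar convention `νH = (eA⁻¹_* ⊗_w ν_w) ⊗ ν_B` and for a product test function `fH (a, b) = (∏_w f_w((eA a)_w)) · g b` whose `w₀`-factor is the restriction of an ambient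
  `f₀ ∈ C_c(M₂(ℂ))` (`f w₀ = f₀ ∘ coe`), (P1) ★ `chartOrbH_eq_prod_chartOrbHLoc` gives `hP` with `G c = ν_B(B) · g((endoTorus S c).2)` and `φ w = chartOrbHLoc L S w ν_w f_w` (so `hG1`
  by §1), and (P4) ★ `chartOrbHLoc_eq_integral_of_not_mem` gives `hQ` with `κ = 1` (at the compact place `w₀ ∉ S` the local chart point IS the Cayley-torus element
  `P·diag(e^{iv₀}, e^{iv₂})·P⁻¹`, ★ `coe_endoBlock_eq_cayley_of_not_mem`).  Conclusion: the jump of `ν ↦ stOrbFamH L νH fH S (s + ν • nrm w₀)` is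
  `ν_B(B) · g((endoTorus S s).2) · ∏_{w ≠ w₀} L_w(s w) · 2i · C₁ · cone(f₀, e^{i s₀})`.
* §3 **`hasOneSidedJump_cayPt_of_jump_of_value`** — DOCKING TO THE (I₃)∕RULINGS #4 (JH) SHAPE, by statement: a jump `G s · ∏_{w ≠ w₀} L_w[φ](s w) · J₀` (★ p850206 ∕ §2) and
  a Cayley value `stOrbFamH … (insert w₀ S) (cayPt w₀ s) = g₀ · ∏_w (w = w₀ ? ℓ₀ : L_w[φ′](s w))` (★ `stOrbFamH_insert_cayPt_eq_mul_prod_of_continuousAt`) with `g₀ = G s`,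
  spectators `φ′ w = φ w` off `w₀` and a constant `cH` with `cH · ℓ₀ = J₀` give **`HasOneSidedJump (ν ↦ stOrbFamH … S (s + ν • nrm w₀)) (cH · stOrbFamH … (insert w₀ S) (cayPt w₀ s))`**
  (`Finset.mul_prod_erase` at `w₀`).
* §4 **`exists_hasOneSidedJump_stOrbFamH_cayPt_prod`** — §2 + §3 + ★ (I₂@cayPt) on the product road: the Cayley value is read through (P1) on the chart `insert w₀ S`, whose
  spectator functionals ARE those of `S` at `w ≠ w₀` (★ (T-CONGR) `chartOrbHLoc_insert_of_ne`); remaining inputs BY STATEMENT: continuity of the spectator local functionals at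
  the regular local points (`hsplit`, `hcpt` — (P-cont)), continuity of `g`, the (A0) limit `ℓ₀` of the split `w₀`-factor of the chart `insert w₀ S` ((A0-b) after (DOCK-w₀)), and
  the MATCHING `cH · ℓ₀ = 2i · C₁ · cone(f₀, e^{i s₀})` ((A0-c)).  With (N1) (product bumps, LH2-p04), (N2)∕(N3) (non-vanishing, LH5-p04 ★ p850271) this is the (JH) brick of
  ★-to-be `agreesOnAdmissibleCoveredSlots_of_bricks` (LH4-p03).
HONEST LABEL: HC_CM is proved only modulo the 7 printed citations (2 remaining: hLiu418 = `stmt-HodgeConjecture-24832`, h413 = `stmt-HodgeConjecture-24833`) until rung 0 closes;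
count-neutral; (A0-b)∕(A0-c)∕(P-cont) enter §4 by statement.

## References
* [Shelstad1979] D. Shelstad, *Characters and inner forms of a quasi-split group over ℝ*, Compositio Math. 39 (1979), Lemma 4.3 p. 25, Thm. 4.7 (IIIb) p. 31, §4 pp. 22–23.
* [Bouaziz1994IntegralesOrbitales] A. Bouaziz, *Intégrales orbitales sur les groupes de Lie réductifs*, Ann. Sci. ÉNS 27 (1994), §3.1 (I₂) p. 579, §3.2 (I₃) p. 580, §6.2 p. 591.
* [Rogawski1990] J. D. Rogawski, *Automorphic Representations of Unitary Groups in Three Variables*, Ann. of Math. Stud. 123 (1990), §4.9 p. 54, §8.2 pp. 119, 122, §8.3 p. 124.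
* [BorelJacquet1979] A. Borel, H. Jacquet, *Automorphic forms and automorphic representations*, PSPM 33.1 (1979), §4.1.
-/

set_option autoImplicit false

noncomputable section

open Filter Topology MeasureTheory NumberField NumberField.InfinitePlace Complex Set Function Real
open Literature.NumberTheory.Automorphic Literature.NumberTheory.Automorphic.UnitaryGroup Literature.NumberTheory.Automorphic.ArchCartan
open Literature.NumberTheory.Automorphic.Shelstad1979.StableOrbitalIntegrals
open scoped MatrixGroups

namespace Literature.NumberTheory.Rogawski1990

/-! ## §1 The `U(Φ₁)`-component of the chart reads slot `1` only (and no label) -/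

section Snd

variable (L : Type) [Field L] [NumberField L] [IsCMField L]

/-- **`(endoTorus L S c).2` reads the slot-`1` coordinates only, and does not read the label**: if `c w 1 = c′ w 1` for every `w` then
`(endoTorus L S c).2 = (endoTorus L S′ c′).2` (the `U(Φ₁)_w`-entries are `e^{i c_{w,1}}`, ★ `coe_endoCircle`). [cite: Rogawski1990, §4.9 p. 54; §8.2 p. 122] -/
theorem endoTorus_snd_eq_of_forall_apply_one (S S' : Finset {w : InfinitePlace L // IsComplex w})
    {c c' : {w : InfinitePlace L // IsComplex w} → Fin 3 → ℝ} (h : ∀ w, c w 1 = c' w 1) : (endoTorus L S c).2 = (endoTorus L S' c').2 := by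
  apply (archPiEquivCM 1 L (Matrix.of fun i j : Fin 1 => if i.val + j.val + 1 = 1 then (1 : L) else 0)).injective
  funext w
  rw [archPiEquivCM_endoTorus_snd, archPiEquivCM_endoTorus_snd]
  apply Subtype.ext
  apply Units.ext
  rw [coe_endoCircle, coe_endoCircle, h w]

omit [NumberField L] [IsCMField L] in
/-- The Cayley point keeps every slot-`1` coordinate. [cite: Shelstad1979, Lemma 4.3 p. 25] -/
theorem cayPt_apply_one {W : Type*} [DecidableEq W] (w₀ : W) (s : W → Fin 3 → ℝ) (w : W) : cayPt w₀ s w 1 = s w 1 := by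
  by_cases hw : w = w₀
  · subst hw
    rw [cayPt_apply_self]
    simp only [Matrix.cons_val_one, Matrix.cons_val_zero]
  · rw [cayPt_apply_of_ne hw]

end Snd

/-! ## §2 The (J-H) jump VALUE on product test functions — `hP`, `hG1`, `hQ` discharged (κ = 1) -/

section ProductJump

open scoped Classical

variable (L : Type) [Field L] [NumberField L] [IsCMField L]
  [∀ w : {w : InfinitePlace L // IsComplex w}, MeasurableSpace ↥(archLocal L 2 (Matrix.of fun i j : Fin 2 => if i.val + j.val + 1 = 2 then (1 : L) else 0) w)]
  [∀ w : {w : InfinitePlace L // IsComplex w}, BorelSpace ↥(archLocal L 2 (Matrix.of fun i j : Fin 2 => if i.val + j.val + 1 = 2 then (1 : L) else 0) w)]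
  [MeasurableSpace ↥(arch (↥(maximalRealSubfield L)) L (IsCMField.complexConj L) 2 (Matrix.of fun i j : Fin 2 => if i.val + j.val + 1 = 2 then (1 : L) else 0))]
  [BorelSpace ↥(arch (↥(maximalRealSubfield L)) L (IsCMField.complexConj L) 2 (Matrix.of fun i j : Fin 2 => if i.val + j.val + 1 = 2 then (1 : L) else 0))]
  [MeasurableSpace ↥(arch (↥(maximalRealSubfield L)) L (IsCMField.complexConj L) 1 (Matrix.of fun i j : Fin 1 => if i.val + j.val + 1 = 1 then (1 : L) else 0))]
  [BorelSpace ↥(arch (↥(maximalRealSubfield L)) L (IsCMField.complexConj L) 1 (Matrix.of fun i j : Fin 1 => if i.val + j.val + 1 = 1 then (1 : L) else 0))]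
  (νw : ∀ w : {w : InfinitePlace L // IsComplex w}, Measure ↥(archLocal L 2 (Matrix.of fun i j : Fin 2 => if i.val + j.val + 1 = 2 then (1 : L) else 0) w))
  [∀ w, (νw w).IsHaarMeasure] [∀ w, (νw w).IsMulRightInvariant]
  (νB : Measure ↥(arch (↥(maximalRealSubfield L)) L (IsCMField.complexConj L) 1 (Matrix.of fun i j : Fin 1 => if i.val + j.val + 1 = 1 then (1 : L) else 0)))
  [νB.IsHaarMeasure] [νB.IsMulRightInvariant]
  (νH : Measure (↥(arch (↥(maximalRealSubfield L)) L (IsCMField.complexConj L) 2 (Matrix.of fun i j : Fin 2 => if i.val + j.val + 1 = 2 then (1 : L) else 0)) ×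
      ↥(arch (↥(maximalRealSubfield L)) L (IsCMField.complexConj L) 1 (Matrix.of fun i j : Fin 1 => if i.val + j.val + 1 = 1 then (1 : L) else 0))))
  [νH.IsHaarMeasure] [νH.IsMulRightInvariant]
  (hν : νH = ((Measure.pi νw).map (archPiEquivCM 2 L (Matrix.of fun i j : Fin 2 => if i.val + j.val + 1 = 2 then (1 : L) else 0)).symm).prod νB)
  (w₀ : {w : InfinitePlace L // IsComplex w})

include hν in
/-- **(J-H) ORDER 0 ON PRODUCT TEST FUNCTIONS — THE JUMP VALUE, BINDER-FREE.**  There is ONE `C₁ > 0` (★ p850182's, depending on the Haar measure `ν_{w₀}` of `U(Φ₂)_{w₀}`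
only) such that: under the product Haar convention `νH = (eA⁻¹_* ⊗_w ν_w) ⊗ ν_B`, for every product test function `fH (a, b) = (∏_w f_w((eA a)_w)) · g b` whose `w₀`-factor is
the restriction `f_{w₀} = f₀ ∘ coe` of a continuous compactly supported `f₀` on `M₂(ℂ)`, every label `S` with `w₀ ∉ S` and every semiregular wall point `s` of the noncompact
imaginary wall `θ₀ = θ₂` at `w₀` (regular at the other places), the genuine stable orbital family along the normal curve JUMPS BY
`ν_B(B) · g((endoTorus S s).2) · (∏_{w ≠ w₀} L_w(s w)) · 2i · C₁ · cone(f₀, e^{i s_{w₀,0}})`, `L_w` the regular local factors of the spectator functionals `chartOrbHLoc L S w ν_w f_w`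
(split: `|e^{x} − e^{−x}| · φ`, compact: `(1 − e^{i(θ₂−θ₀)}) · (φ + φ^flip)`) and `cone` the two-nappe cone integral of ★ (K0±).  (★ p850206 with (P1), §1 and (P4): `κ = 1`.)
[cite: Shelstad1979, Lemma 4.3 p. 25; Thm. 4.7 (IIIb) p. 31] [cite: Bouaziz1994IntegralesOrbitales, §3.2 (I₃) p. 580; §6.2 p. 591] [cite: Rogawski1990, §8.2 pp. 119, 122; §8.3 p. 124]
[cite: BorelJacquet1979, §4.1] -/
theorem exists_hasOneSidedJump_stOrbFamH_add_smul_nrm_prod :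
    ∃ C₁ : ℝ, 0 < C₁ ∧
      ∀ (fH : ↥(arch (↥(maximalRealSubfield L)) L (IsCMField.complexConj L) 2 (Matrix.of fun i j : Fin 2 => if i.val + j.val + 1 = 2 then (1 : L) else 0)) ×
          ↥(arch (↥(maximalRealSubfield L)) L (IsCMField.complexConj L) 1 (Matrix.of fun i j : Fin 1 => if i.val + j.val + 1 = 1 then (1 : L) else 0)) → ℂ)
        (f : ∀ w : {w : InfinitePlace L // IsComplex w}, ↥(archLocal L 2 (Matrix.of fun i j : Fin 2 => if i.val + j.val + 1 = 2 then (1 : L) else 0) w) → ℂ)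
        (g : ↥(arch (↥(maximalRealSubfield L)) L (IsCMField.complexConj L) 1 (Matrix.of fun i j : Fin 1 => if i.val + j.val + 1 = 1 then (1 : L) else 0)) → ℂ)
        (_ : ∀ a b, fH (a, b) = (∏ w, f w (archPiEquivCM 2 L (Matrix.of fun i j : Fin 2 => if i.val + j.val + 1 = 2 then (1 : L) else 0) a w)) * g b)
        (f₀ : Matrix (Fin 2) (Fin 2) ℂ → ℂ) (_ : Continuous f₀) (_ : HasCompactSupport f₀)
        (_ : ∀ x : ↥(archLocal L 2 (Matrix.of fun i j : Fin 2 => if i.val + j.val + 1 = 2 then (1 : L) else 0) w₀), f w₀ x = f₀ ((x : GL (Fin 2) ℂ) : Matrix (Fin 2) (Fin 2) ℂ))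
        (S : Finset {w : InfinitePlace L // IsComplex w}) (_ : w₀ ∉ S)
        (s : {w : InfinitePlace L // IsComplex w} → Fin 3 → ℝ) (_ : s w₀ 0 = s w₀ 2)
        (_ : ∀ w, w ∉ S → w ≠ w₀ → Circle.exp (s w 0) ≠ Circle.exp (s w 2)) (_ : ∀ w ∈ S, s w 0 ≠ 0),
        HasOneSidedJump (fun ν : ℝ => stOrbFamH L νH fH S (s + ν • nrm w₀))
          ((νB.real Set.univ : ℂ) * g (endoTorus L S s).2 *
            (∏ w ∈ Finset.univ.erase w₀, (if w ∈ S then (((|Real.exp (s w 0) - Real.exp (-s w 0)| : ℝ) : ℂ) * chartOrbHLoc L S w (νw w) (f w) (s w))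
              else (1 - (Circle.exp (s w 2 - s w 0) : ℂ)) * (chartOrbHLoc L S w (νw w) (f w) (s w) + chartOrbHLoc L S w (νw w) (f w) ![s w 2, s w 1, s w 0]))) *
            (2 * I * ((C₁ : ℂ) * ((∫ p in Ioi (0 : ℝ) ×ˢ Ioc (0 : ℝ) (2 * π),
                f₀ ((!![(1 : ℂ), 1; 1, -1] : Matrix (Fin 2) (Fin 2) ℂ) *
                  (((Circle.exp (s w₀ 0) : Circle) : ℂ) • (1 : Matrix (Fin 2) (Fin 2) ℂ) +
                    p.1 • Matrix.diagonal ![((Circle.exp (s w₀ 0) : Circle) : ℂ) * I, -(((Circle.exp (s w₀ 0) : Circle) : ℂ) * I)] +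
                    p.1 • !![(0 : ℂ), -(((Circle.exp (s w₀ 0) : Circle) : ℂ) * I) * cexp (-((p.2 : ℂ) * I));
                      (((Circle.exp (s w₀ 0) : Circle) : ℂ) * I) * cexp ((p.2 : ℂ) * I), 0]) *
                  !![(1 / 2 : ℂ), 1 / 2; 1 / 2, -(1 / 2)])) +
              ∫ p in Ioi (0 : ℝ) ×ˢ Ioc (0 : ℝ) (2 * π),
                f₀ ((!![(1 : ℂ), 1; 1, -1] : Matrix (Fin 2) (Fin 2) ℂ) *
                  (((Circle.exp (s w₀ 0) : Circle) : ℂ) • (1 : Matrix (Fin 2) (Fin 2) ℂ) +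
                    p.1 • Matrix.diagonal ![-(((Circle.exp (s w₀ 0) : Circle) : ℂ) * I), ((Circle.exp (s w₀ 0) : Circle) : ℂ) * I] +
                    p.1 • !![(0 : ℂ), (((Circle.exp (s w₀ 0) : Circle) : ℂ) * I) * cexp (-((p.2 : ℂ) * I));
                      -(((Circle.exp (s w₀ 0) : Circle) : ℂ) * I) * cexp ((p.2 : ℂ) * I), 0]) *
                  !![(1 / 2 : ℂ), 1 / 2; 1 / 2, -(1 / 2)]))))) := by
  obtain ⟨C₁, hC₁, hJ⟩ := exists_hasOneSidedJump_stOrbFamH_add_smul_nrm L νH w₀ (νw w₀)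
  refine ⟨C₁, hC₁, fun fH f g hfH f₀ hf₀ hf₀c hfw₀ S hw₀ s hs hreg hregS => ?_⟩
  -- the `w₀`-factor is Borel measurable (it is the restriction of the continuous `f₀`)
  have hmeas : Measurable (f w₀) := by
    have e : f w₀ = fun x : ↥(archLocal L 2 (Matrix.of fun i j : Fin 2 => if i.val + j.val + 1 = 2 then (1 : L) else 0) w₀) =>
        f₀ ((x : GL (Fin 2) ℂ) : Matrix (Fin 2) (Fin 2) ℂ) := funext hfw₀
    rw [e]
    exact (hf₀.comp (Units.continuous_val.comp continuous_subtype_val)).measurable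
  -- at the compact place `w₀ ∉ S` the local chart point IS the Cayley-torus element of ★ p850206's `hQ`
  have hE : ∀ v : Fin 3 → ℝ, endoBlockAt L S w₀ v =
      ⟨Matrix.GeneralLinearGroup.mkOfDetNeZero !![(1 : ℂ), 1; 1, -1] det_cayleyTwo_ne_zero * circleDiagonal 2 ![Circle.exp (v 0), Circle.exp (v 2)] *
          (Matrix.GeneralLinearGroup.mkOfDetNeZero !![(1 : ℂ), 1; 1, -1] det_cayleyTwo_ne_zero)⁻¹,
        cayley_conj_circleDiagonal_mem_archLocal L w₀ _⟩ :=
    fun v => Subtype.ext (coe_endoBlock_eq_cayley_of_not_mem L S (fun _ => v) hw₀)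
  have h := hJ fH S hw₀ s hs hreg hregS (fun c => (νB.real Set.univ : ℂ) * g (endoTorus L S c).2) (fun w v => chartOrbHLoc L S w (νw w) (f w) v)
    (fun c _ => chartOrbH_eq_prod_chartOrbHLoc L S νw νB νH hν fH f g hfH c)
    (fun c c' hc => by rw [endoTorus_snd_eq_of_forall_apply_one L S S hc])
    1 f₀ hf₀ hf₀c (fun v => by
      rw [one_mul, chartOrbHLoc_eq_integral_of_not_mem L S w₀ (νw w₀) hw₀ (f w₀) hmeas v, hE v]
      simp_rw [hfw₀])
  simpa only [one_mul] using h

end ProductJump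

/-! ## §3 Docking to the (I₃) ∕ (JH) shape `cH · Ψ_{S′}(cayPt)` — by statement -/

section Docking

open scoped Classical

variable (L : Type) [Field L] [NumberField L] [IsCMField L]
  [MeasurableSpace (↥(arch (↥(maximalRealSubfield L)) L (IsCMField.complexConj L) 2 (Matrix.of fun i j : Fin 2 => if i.val + j.val + 1 = 2 then (1 : L) else 0)) ×
      ↥(arch (↥(maximalRealSubfield L)) L (IsCMField.complexConj L) 1 (Matrix.of fun i j : Fin 1 => if i.val + j.val + 1 = 1 then (1 : L) else 0)))]
  [BorelSpace (↥(arch (↥(maximalRealSubfield L)) L (IsCMField.complexConj L) 2 (Matrix.of fun i j : Fin 2 => if i.val + j.val + 1 = 2 then (1 : L) else 0)) ×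
      ↥(arch (↥(maximalRealSubfield L)) L (IsCMField.complexConj L) 1 (Matrix.of fun i j : Fin 1 => if i.val + j.val + 1 = 1 then (1 : L) else 0)))]
  (νH : Measure (↥(arch (↥(maximalRealSubfield L)) L (IsCMField.complexConj L) 2 (Matrix.of fun i j : Fin 2 => if i.val + j.val + 1 = 2 then (1 : L) else 0)) ×
      ↥(arch (↥(maximalRealSubfield L)) L (IsCMField.complexConj L) 1 (Matrix.of fun i j : Fin 1 => if i.val + j.val + 1 = 1 then (1 : L) else 0))))
  [IsFiniteMeasureOnCompacts νH] [νH.IsMulRightInvariant]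

/-- **DOCKING THE (J-H) JUMP TO THE (I₃) ORDER-0 READING `cH · Ψ_{S′}(cayPt)`** (RULINGS #4 (JH) shape), BY STATEMENT.  Given, at a wall point `s` of `w₀ ∉ S`:
the jump `G s · (∏_{w ≠ w₀} L_w[φ](s w)) · J₀` of the family along the normal curve (★ p850206 ∕ §2: `J₀ = κ · 2i C₁ cone`), the Cayley value
`Ψ (insert w₀ S) (cayPt w₀ s) = g₀ · ∏_w (w = w₀ ? ℓ₀ : L_w[φ′](s w))` (★ `stOrbFamH_insert_cayPt_eq_mul_prod_of_continuousAt`) with `g₀ = G s` and the SAME spectators off `w₀`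
(`φ′ w = φ w`, ★ (T-CONGR) on the product road), and any constant `cH` with the MATCHING `cH · ℓ₀ = J₀` ((A0-c)), the jump IS `cH · Ψ (insert w₀ S) (cayPt w₀ s)` — the spectator
products cancel place by place (`Finset.mul_prod_erase` at `w₀`). [cite: Bouaziz1994IntegralesOrbitales, §3.2 (I₃) p. 580; §6.2 p. 591] [cite: Shelstad1979, Lemma 4.3 p. 25; Thm. 4.7 (IIIb) p. 31] -/
theorem hasOneSidedJump_cayPt_of_jump_of_value
    (fH : ↥(arch (↥(maximalRealSubfield L)) L (IsCMField.complexConj L) 2 (Matrix.of fun i j : Fin 2 => if i.val + j.val + 1 = 2 then (1 : L) else 0)) ×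
      ↥(arch (↥(maximalRealSubfield L)) L (IsCMField.complexConj L) 1 (Matrix.of fun i j : Fin 1 => if i.val + j.val + 1 = 1 then (1 : L) else 0)) → ℂ)
    (S : Finset {w : InfinitePlace L // IsComplex w}) (w₀ : {w : InfinitePlace L // IsComplex w}) (s : {w : InfinitePlace L // IsComplex w} → Fin 3 → ℝ)
    {G : ({w : InfinitePlace L // IsComplex w} → Fin 3 → ℝ) → ℂ} {φ φ' : {w : InfinitePlace L // IsComplex w} → (Fin 3 → ℝ) → ℂ} {J₀ : ℂ}
    (hJ : HasOneSidedJump (fun ν : ℝ => stOrbFamH L νH fH S (s + ν • nrm w₀))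
      (G s * (∏ w ∈ Finset.univ.erase w₀, (if w ∈ S then (((|Real.exp (s w 0) - Real.exp (-s w 0)| : ℝ) : ℂ) * φ w (s w))
        else (1 - (Circle.exp (s w 2 - s w 0) : ℂ)) * (φ w (s w) + φ w ![s w 2, s w 1, s w 0]))) * J₀))
    {g₀ ℓ₀ : ℂ}
    (hV : stOrbFamH L νH fH (insert w₀ S) (cayPt w₀ s) =
      g₀ * ∏ w, (if w = w₀ then ℓ₀ else if w ∈ S then (((|Real.exp (s w 0) - Real.exp (-s w 0)| : ℝ) : ℂ) * φ' w (s w))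
        else (1 - (Circle.exp (s w 2 - s w 0) : ℂ)) * (φ' w (s w) + φ' w ![s w 2, s w 1, s w 0])))
    (hg₀ : g₀ = G s) (hφ : ∀ w, w ≠ w₀ → φ' w = φ w) {cH : ℂ} (hcH : cH * ℓ₀ = J₀) :
    HasOneSidedJump (fun ν : ℝ => stOrbFamH L νH fH S (s + ν • nrm w₀)) (cH * stOrbFamH L νH fH (insert w₀ S) (cayPt w₀ s)) := by
  refine HasOneSidedJump.jump_congr hJ ?_
  rw [hV, hg₀, ← Finset.mul_prod_erase Finset.univ _ (Finset.mem_univ w₀), if_pos rfl, ← hcH]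
  have hspec : ∏ w ∈ Finset.univ.erase w₀, (if w = w₀ then ℓ₀ else if w ∈ S then (((|Real.exp (s w 0) - Real.exp (-s w 0)| : ℝ) : ℂ) * φ' w (s w))
        else (1 - (Circle.exp (s w 2 - s w 0) : ℂ)) * (φ' w (s w) + φ' w ![s w 2, s w 1, s w 0])) =
      ∏ w ∈ Finset.univ.erase w₀, (if w ∈ S then (((|Real.exp (s w 0) - Real.exp (-s w 0)| : ℝ) : ℂ) * φ w (s w))
        else (1 - (Circle.exp (s w 2 - s w 0) : ℂ)) * (φ w (s w) + φ w ![s w 2, s w 1, s w 0])) :=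
    Finset.prod_congr rfl fun w hw => by rw [if_neg (Finset.ne_of_mem_erase hw), hφ w (Finset.ne_of_mem_erase hw)]
  rw [hspec]
  ring

end Docking

/-! ## §4 The (JH) brick on the product road: `HasOneSidedJump … (cH · Ψ_{insert w₀ S}(cayPt))` modulo (P-cont), (A0-b), (A0-c) by statement -/

section ProductDocking

open scoped Classical

variable (L : Type) [Field L] [NumberField L] [IsCMField L]
  [∀ w : {w : InfinitePlace L // IsComplex w}, MeasurableSpace ↥(archLocal L 2 (Matrix.of fun i j : Fin 2 => if i.val + j.val + 1 = 2 then (1 : L) else 0) w)]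
  [∀ w : {w : InfinitePlace L // IsComplex w}, BorelSpace ↥(archLocal L 2 (Matrix.of fun i j : Fin 2 => if i.val + j.val + 1 = 2 then (1 : L) else 0) w)]
  [MeasurableSpace ↥(arch (↥(maximalRealSubfield L)) L (IsCMField.complexConj L) 2 (Matrix.of fun i j : Fin 2 => if i.val + j.val + 1 = 2 then (1 : L) else 0))]
  [BorelSpace ↥(arch (↥(maximalRealSubfield L)) L (IsCMField.complexConj L) 2 (Matrix.of fun i j : Fin 2 => if i.val + j.val + 1 = 2 then (1 : L) else 0))]
  [MeasurableSpace ↥(arch (↥(maximalRealSubfield L)) L (IsCMField.complexConj L) 1 (Matrix.of fun i j : Fin 1 => if i.val + j.val + 1 = 1 then (1 : L) else 0))]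
  [BorelSpace ↥(arch (↥(maximalRealSubfield L)) L (IsCMField.complexConj L) 1 (Matrix.of fun i j : Fin 1 => if i.val + j.val + 1 = 1 then (1 : L) else 0))]
  (νw : ∀ w : {w : InfinitePlace L // IsComplex w}, Measure ↥(archLocal L 2 (Matrix.of fun i j : Fin 2 => if i.val + j.val + 1 = 2 then (1 : L) else 0) w))
  [∀ w, (νw w).IsHaarMeasure] [∀ w, (νw w).IsMulRightInvariant]
  (νB : Measure ↥(arch (↥(maximalRealSubfield L)) L (IsCMField.complexConj L) 1 (Matrix.of fun i j : Fin 1 => if i.val + j.val + 1 = 1 then (1 : L) else 0)))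
  [νB.IsHaarMeasure] [νB.IsMulRightInvariant]
  (νH : Measure (↥(arch (↥(maximalRealSubfield L)) L (IsCMField.complexConj L) 2 (Matrix.of fun i j : Fin 2 => if i.val + j.val + 1 = 2 then (1 : L) else 0)) ×
      ↥(arch (↥(maximalRealSubfield L)) L (IsCMField.complexConj L) 1 (Matrix.of fun i j : Fin 1 => if i.val + j.val + 1 = 1 then (1 : L) else 0))))
  [νH.IsHaarMeasure] [νH.IsMulRightInvariant]
  (hν : νH = ((Measure.pi νw).map (archPiEquivCM 2 L (Matrix.of fun i j : Fin 2 => if i.val + j.val + 1 = 2 then (1 : L) else 0)).symm).prod νB)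
  (w₀ : {w : InfinitePlace L // IsComplex w})

include hν in
/-- **THE (JH) BRICK ON THE PRODUCT ROAD.**  With the SAME `C₁ > 0` as §2: for every product test function `fH (a, b) = (∏_w f_w((eA a)_w)) · g b` (`g` continuous,
`f_{w₀} = f₀ ∘ coe`, `f₀ ∈ C_c(M₂(ℂ))`), every label `S ∌ w₀`, every semiregular wall point `s` of the wall `θ₀ = θ₂` at `w₀`, given BY STATEMENT
* (P-cont) continuity of the spectator local functionals `chartOrbHLoc L S w ν_w f_w` at the regular local points `s w` (and at the flipped triple for compact `w`),
* (A0-b) the limit `ℓ₀` of `|e^{x}−e^{−x}| · chartOrbHLoc L (insert w₀ S) w₀ ν_{w₀} f_{w₀} (x, θ₁, θ)` as `(x, θ₁, θ) → (0, s_{w₀,1}, s_{w₀,0})` within `x ≠ 0`,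
* (A0-c) the MATCHING `cH · ℓ₀ = 2i · C₁ · cone(f₀, e^{i s_{w₀,0}})` (the two-nappe cone integral of ★ (K0±), verbatim),
the genuine stable family satisfies the (I₃) order-0 clause with constant `cH`:
**`HasOneSidedJump (ν ↦ stOrbFamH L νH fH S (s + ν • nrm w₀)) (cH · stOrbFamH L νH fH (insert w₀ S) (cayPt w₀ s))`**.
(§2 for the jump; ★ (I₂@cayPt) `stOrbFamH_insert_cayPt_eq_mul_prod_of_continuousAt` for the value, read through (P1) on `insert w₀ S` whose spectators ARE those of `S` off `w₀` by
★ (T-CONGR) `chartOrbHLoc_insert_of_ne`; §3 for the cancellation.) [cite: Bouaziz1994IntegralesOrbitales, §3.1 (I₂) p. 579; §3.2 (I₃) p. 580; §6.2 p. 591]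
[cite: Shelstad1979, Lemma 4.3 p. 25; Thm. 4.7 (IIIb) p. 31] [cite: Rogawski1990, §8.2 pp. 119, 122] -/
theorem exists_hasOneSidedJump_stOrbFamH_cayPt_prod :
    ∃ C₁ : ℝ, 0 < C₁ ∧
      ∀ (fH : ↥(arch (↥(maximalRealSubfield L)) L (IsCMField.complexConj L) 2 (Matrix.of fun i j : Fin 2 => if i.val + j.val + 1 = 2 then (1 : L) else 0)) ×
          ↥(arch (↥(maximalRealSubfield L)) L (IsCMField.complexConj L) 1 (Matrix.of fun i j : Fin 1 => if i.val + j.val + 1 = 1 then (1 : L) else 0)) → ℂ)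
        (f : ∀ w : {w : InfinitePlace L // IsComplex w}, ↥(archLocal L 2 (Matrix.of fun i j : Fin 2 => if i.val + j.val + 1 = 2 then (1 : L) else 0) w) → ℂ)
        (g : ↥(arch (↥(maximalRealSubfield L)) L (IsCMField.complexConj L) 1 (Matrix.of fun i j : Fin 1 => if i.val + j.val + 1 = 1 then (1 : L) else 0)) → ℂ)
        (_ : ∀ a b, fH (a, b) = (∏ w, f w (archPiEquivCM 2 L (Matrix.of fun i j : Fin 2 => if i.val + j.val + 1 = 2 then (1 : L) else 0) a w)) * g b)
        (_ : Continuous g)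
        (f₀ : Matrix (Fin 2) (Fin 2) ℂ → ℂ) (_ : Continuous f₀) (_ : HasCompactSupport f₀)
        (_ : ∀ x : ↥(archLocal L 2 (Matrix.of fun i j : Fin 2 => if i.val + j.val + 1 = 2 then (1 : L) else 0) w₀), f w₀ x = f₀ ((x : GL (Fin 2) ℂ) : Matrix (Fin 2) (Fin 2) ℂ))
        (S : Finset {w : InfinitePlace L // IsComplex w}) (_ : w₀ ∉ S)
        (s : {w : InfinitePlace L // IsComplex w} → Fin 3 → ℝ) (_ : s w₀ 0 = s w₀ 2)
        (_ : ∀ w, w ∉ S → w ≠ w₀ → Circle.exp (s w 0) ≠ Circle.exp (s w 2)) (_ : ∀ w ∈ S, s w 0 ≠ 0)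
        (_ : ∀ w ∈ S, ContinuousAt (chartOrbHLoc L S w (νw w) (f w)) (s w))
        (_ : ∀ w, w ∉ S → w ≠ w₀ → ContinuousAt (chartOrbHLoc L S w (νw w) (f w)) (s w) ∧ ContinuousAt (chartOrbHLoc L S w (νw w) (f w)) ![s w 2, s w 1, s w 0])
        (ℓ₀ : ℂ)
        (_ : Tendsto (fun v : Fin 3 → ℝ => (((|Real.exp (v 0) - Real.exp (-v 0)| : ℝ) : ℂ) * chartOrbHLoc L (insert w₀ S) w₀ (νw w₀) (f w₀) v))
          (𝓝[{v : Fin 3 → ℝ | v 0 ≠ 0}] ![0, s w₀ 1, s w₀ 0]) (𝓝 ℓ₀))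
        (cH : ℂ)
        (_ : cH * ℓ₀ = 2 * I * ((C₁ : ℂ) * ((∫ p in Ioi (0 : ℝ) ×ˢ Ioc (0 : ℝ) (2 * π),
                f₀ ((!![(1 : ℂ), 1; 1, -1] : Matrix (Fin 2) (Fin 2) ℂ) *
                  (((Circle.exp (s w₀ 0) : Circle) : ℂ) • (1 : Matrix (Fin 2) (Fin 2) ℂ) +
                    p.1 • Matrix.diagonal ![((Circle.exp (s w₀ 0) : Circle) : ℂ) * I, -(((Circle.exp (s w₀ 0) : Circle) : ℂ) * I)] +
                    p.1 • !![(0 : ℂ), -(((Circle.exp (s w₀ 0) : Circle) : ℂ) * I) * cexp (-((p.2 : ℂ) * I));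
                      (((Circle.exp (s w₀ 0) : Circle) : ℂ) * I) * cexp ((p.2 : ℂ) * I), 0]) *
                  !![(1 / 2 : ℂ), 1 / 2; 1 / 2, -(1 / 2)])) +
              ∫ p in Ioi (0 : ℝ) ×ˢ Ioc (0 : ℝ) (2 * π),
                f₀ ((!![(1 : ℂ), 1; 1, -1] : Matrix (Fin 2) (Fin 2) ℂ) *
                  (((Circle.exp (s w₀ 0) : Circle) : ℂ) • (1 : Matrix (Fin 2) (Fin 2) ℂ) +
                    p.1 • Matrix.diagonal ![-(((Circle.exp (s w₀ 0) : Circle) : ℂ) * I), ((Circle.exp (s w₀ 0) : Circle) : ℂ) * I] +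
                    p.1 • !![(0 : ℂ), (((Circle.exp (s w₀ 0) : Circle) : ℂ) * I) * cexp (-((p.2 : ℂ) * I));
                      -(((Circle.exp (s w₀ 0) : Circle) : ℂ) * I) * cexp ((p.2 : ℂ) * I), 0]) *
                  !![(1 / 2 : ℂ), 1 / 2; 1 / 2, -(1 / 2)])))),
        HasOneSidedJump (fun ν : ℝ => stOrbFamH L νH fH S (s + ν • nrm w₀)) (cH * stOrbFamH L νH fH (insert w₀ S) (cayPt w₀ s)) := by
  obtain ⟨C₁, hC₁, hJ⟩ := exists_hasOneSidedJump_stOrbFamH_add_smul_nrm_prod L νw νB νH hν w₀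
  refine ⟨C₁, hC₁, fun fH f g hfH hg f₀ hf₀ hf₀c hfw₀ S hw₀ s hs hreg hregS hsplit hcpt ℓ₀ hA0 cH hcH => ?_⟩
  -- the Cayley value on the product road, chart `insert w₀ S`
  have hG : ∀ T : Finset {w : InfinitePlace L // IsComplex w}, (∀ w ∈ T, w ∉ insert w₀ S) → ∀ c : {w : InfinitePlace L // IsComplex w} → Fin 3 → ℝ,
      (νB.real Set.univ : ℂ) * g (endoTorus L (insert w₀ S) (flipSet T c)).2 = (νB.real Set.univ : ℂ) * g (endoTorus L (insert w₀ S) c).2 := fun T _ c => by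
    rw [endoTorus_snd_eq_of_forall_apply_one L (insert w₀ S) (insert w₀ S) (c := flipSet T c) (c' := c) fun w => by
      rw [flipSet_apply]; split_ifs <;> simp]
  have hGc : Continuous fun c : {w : InfinitePlace L // IsComplex w} → Fin 3 → ℝ => (νB.real Set.univ : ℂ) * g (endoTorus L (insert w₀ S) c).2 :=
    continuous_const.mul (hg.comp (continuous_snd.comp (continuous_endoTorus L (insert w₀ S))))
  have hGt : Tendsto (fun c : {w : InfinitePlace L // IsComplex w} → Fin 3 → ℝ => (νB.real Set.univ : ℂ) * g (endoTorus L (insert w₀ S) c).2)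
      (𝓝[RegS (insert w₀ S)] (cayPt w₀ s)) (𝓝 ((νB.real Set.univ : ℂ) * g (endoTorus L S s).2)) := by
    have h1 : (νB.real Set.univ : ℂ) * g (endoTorus L (insert w₀ S) (cayPt w₀ s)).2 = (νB.real Set.univ : ℂ) * g (endoTorus L S s).2 := by
      rw [endoTorus_snd_eq_of_forall_apply_one L (insert w₀ S) S (cayPt_apply_one w₀ s)]
    rw [← h1]
    exact hGc.continuousAt.continuousWithinAt.tendsto
  have hV := stOrbFamH_insert_cayPt_eq_mul_prod_of_continuousAt L νH fH S hw₀ hs hreg hregS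
    (G := fun c => (νB.real Set.univ : ℂ) * g (endoTorus L (insert w₀ S) c).2) (φ := fun w v => chartOrbHLoc L (insert w₀ S) w (νw w) (f w) v)
    (fun c _ => chartOrbH_eq_prod_chartOrbHLoc L (insert w₀ S) νw νB νH hν fH f g hfH c) hG hGt hA0
    (fun w hw => by
      have hne : w ≠ w₀ := fun h => hw₀ (h ▸ hw)
      simpa only [chartOrbHLoc_insert_of_ne L w (νw w) hne S (f w)] using hsplit w hw)
    (fun w hw hne => by
      simpa only [chartOrbHLoc_insert_of_ne L w (νw w) hne S (f w)] using hcpt w hw hne)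
  exact hasOneSidedJump_cayPt_of_jump_of_value L νH fH S w₀ s (G := fun c => (νB.real Set.univ : ℂ) * g (endoTorus L S c).2)
    (φ := fun w => chartOrbHLoc L S w (νw w) (f w)) (φ' := fun w => chartOrbHLoc L (insert w₀ S) w (νw w) (f w))
    (hJ fH f g hfH f₀ hf₀ hf₀c hfw₀ S hw₀ s hs hreg hregS) hV rfl (fun w hne => funext fun v => chartOrbHLoc_insert_of_ne L w (νw w) hne S (f w) v) hcH

end ProductDocking

end Literature.NumberTheory.Rogawski1990

end
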